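import Mathlib
import Summits.ValiantsHypothesis.ValiantsHypothesis.Theorems.FifoMatchingNNMonotoneExpBound
import HarnessLib

/-!
# Crux `FifoMatching.NNLowDegreeCofactorHard` (stmt-ValiantsHypothesis-22993), line `freed-vertices`:
# the monotone bound `2^{n^{1/6}} ≤ L₊(g)` for EVERY `g` with the support of `NN_n`

Helper file for the registered stub `stub_supportGenericQPHard` (S3) of
`Cruxes/NNLowDegreeCofactorHard/Lines/freed_vertices.lean` (proved by name in
`FifoMatchingNNLowDegreeCofactorHardStubSupportGenericQPHard.lean`, which imports this file).

(1) The union bound of the crux `NNMonotoneHard`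
(`NNMonotoneHard.exists_balanced_split_of_complexity`) reads only the SUPPORT of the polynomial:
the homogeneous structure theorem needs homogeneity (read off `supp g = supp NN_n`,
`isHomogeneous_of_support_eq`), and "balanced products live on one vertex split" needs only
`supp(a·b) ⊆ supp NN_n` (`exists_balanced_vertex_split_of_support_subset`); hence
`exists_balanced_split_of_complexity_of_support_eq` and
`one_le_complexity_mul_of_spread_of_support_eq`.  (2) The thick-queue measure of
`NNMonotoneExpBound` (stmt-22994, `exists_thick_measure_of_le`, parameters polynomial in one
integer `u`, `n < 13600 u⁵ ≤ u⁶`) beats `2^u` against `4(n+1)²`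
(`exists_spread_measure_beating` = the arithmetic of `NNMonotoneExpBound.exp_lower_bound` with
the measure exposed), so `2^{n^{1/6}} ≤ 2^u ≤ L₊(g)` for every such `g`
(`exp_lower_bound_of_support_eq`).

Honest framing: a support-generic re-run of a PROVED monotone rung (22994/11617); VP ≠ VNP is
not moved by this file (monotone ≠ general, `Literature.Barriers.ValiantsHypothesis.MonotoneGap`).
No definitions, no named facts.
-/

noncomputable section

-- Sub = Summit single-conjunct layout: the duplicated namespace component is mandated by the tree.
set_option linter.dupNamespace false

namespace Summit.ValiantsHypothesis.ValiantsHypothesis.Theorems.FifoMatching.NNLowDegreeCofactorHard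

open MvPolynomial Finset Filter Literature.Computability.AlgebraicComplexity
open Summit.ValiantsHypothesis.ValiantsHypothesis.Theorems.FifoMatching.NNMonotoneHard
open Summit.ValiantsHypothesis.ValiantsHypothesis.Theorems.FifoMatching.NNMonotoneExpBound
open scoped NNReal Topology

variable {m : ℕ}

/-! ### The union bound reads only the support -/

/-- A polynomial with the support of `NN_n` is homogeneous of degree `n`. [folklore] -/
theorem isHomogeneous_of_support_eq {n : ℕ} {g : MvPolynomial (Fin (2 * n) × Fin (2 * n)) ℝ≥0}
    (hg : g.support = (nestFreeMatchingPoly n ℝ≥0).support) : g.IsHomogeneous n := by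
  intro d hd
  have hd' : d ∈ (nestFreeMatchingPoly n ℝ≥0).support := by
    rw [← hg, mem_support_iff]
    exact hd
  exact nestFreeMatchingPoly_isHomogeneous n (mem_support_iff.1 hd')

/-- **Balanced products live on one vertex split (support form).** Let `𝓕` be a family of perfect
matchings of `Fin m`.  If `a` is homogeneous of degree `d`, `a · b ≠ 0` and every monomial of
`a · b` is a monomial of `Σ_{M ∈ 𝓕} x^M`, then there is a set `S` of `2d` points such that every
monomial of `a · b` is the arc set of a member of `𝓕` respecting `S` (the proof of
`NNMonotoneHard.exists_balanced_vertex_split`, which assumed coefficientwise domination, uses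
only this support inclusion). [folklore] -/
theorem exists_balanced_vertex_split_of_support_subset {𝓕 : Finset (Fin m → Fin m)}
    (h𝓕 : 𝓕 ⊆ perfectMatchings m) {a b : MvPolynomial (Fin m × Fin m) ℝ≥0} {d : ℕ}
    (ha : a.IsHomogeneous d) (hab : a * b ≠ 0)
    (hsub : (a * b).support ⊆ (∑ M ∈ 𝓕, arcMonomial ℝ≥0 M).support) :
    ∃ S : Finset (Fin m), S.card = 2 * d ∧
      ∀ x ∈ (a * b).support, ∃ M ∈ 𝓕, arcExponent M = x ∧ ∀ i, i ∈ S ↔ M i ∈ S := by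
  classical
  -- every monomial of `a b` is the arc set of a member of `𝓕`
  have hmem : ∀ x ∈ (a * b).support, ∃ M ∈ 𝓕, arcExponent M = x := by
    intro x hx
    have hx' := hsub hx
    rw [support_sum_arcMonomial h𝓕, mem_image] at hx'
    exact hx'
  have hb : b ≠ 0 := fun h => hab (by rw [h, mul_zero])
  obtain ⟨h₀, hh₀⟩ := support_nonempty.2 hb
  -- the split: the complement of the vertex set of `h₀`
  set S : Finset (Fin m) := univ.filter fun i => ¬ ∃ j, h₀ (i, j) ≠ 0 ∨ h₀ (j, i) ≠ 0 with hS
  -- the vertex set of every monomial of `a` is `S`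
  have hverts : ∀ g ∈ a.support, ∀ i, i ∈ S ↔ ∃ j, g (i, j) ≠ 0 ∨ g (j, i) ≠ 0 := by
    intro g hg i
    obtain ⟨M₀, hM₀, hM₀x⟩ := hmem _ (add_mem_support_mul' hg hh₀)
    set V : Finset (Fin m) := univ.filter fun i => ∃ j, g (i, j) ≠ 0 ∨ g (j, i) ≠ 0 with hV
    have hV' : ∀ i, i ∈ V ↔ ∃ j, g (i, j) ≠ 0 ∨ g (j, i) ≠ 0 := fun i => by simp [hV]
    have key := (respects_and_compl_of_add_eq_arcExponent (h𝓕 hM₀) hM₀x.symm V hV').2 i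
    rw [← hV', key, hS]
    simp
  refine ⟨S, ?_, ?_⟩
  · -- `|S| = 2d`, computed on any monomial of `a`
    have ha0 : a ≠ 0 := fun h => hab (by rw [h, zero_mul])
    obtain ⟨g, hg⟩ := support_nonempty.2 ha0
    obtain ⟨M₀, hM₀, hM₀x⟩ := hmem _ (add_mem_support_mul' hg hh₀)
    rw [card_verts_eq_two_mul_degree (h𝓕 hM₀) hM₀x.symm S (hverts g hg)]
    have hdeg : g.degree = d := by
      have := ha (mem_support_iff.1 hg)
      rw [Finsupp.degree_eq_weight_one]
      exact this
    rw [hdeg]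
  · intro x hx
    obtain ⟨g, hg, h, hh, rfl⟩ := Finset.mem_add.1 (support_mul a b hx)
    obtain ⟨M, hM, hMx⟩ := hmem _ hx
    refine ⟨M, hM, hMx, ?_⟩
    exact (respects_and_compl_of_add_eq_arcExponent (h𝓕 hM) hMx.symm S (hverts g hg)).1

/-- **Union bound, support-generic.** For `n ≥ 3`, every `g ∈ ℝ≥0[x]` with exactly the support of
`NN_n`, and every nonnegative weighting `μ` of the nest-free perfect matchings of `[2n]` of total
mass `1`, some balanced split `S ⊆ [2n]` (`2n < 3|S| ≤ 4n`) is respected with mass at least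
`1 / (4 · L₊(g) · (n+1)²)`: the proof of `NNMonotoneHard.exists_balanced_split_of_complexity`
verbatim, with `g` for `NN_n` (homogeneity and the covering of every matching by some term are
read off the support). [folklore] -/
theorem exists_balanced_split_of_complexity_of_support_eq {n : ℕ} (hn : 3 ≤ n)
    {g : MvPolynomial (Fin (2 * n) × Fin (2 * n)) ℝ≥0}
    (hg : g.support = (nestFreeMatchingPoly n ℝ≥0).support)
    (μ : (Fin (2 * n) → Fin (2 * n)) → ℝ≥0) (hμ : ∑ M ∈ nestFreeMatchings (2 * n), μ M = 1) :
    ∃ S : Finset (Fin (2 * n)), 2 * n < 3 * S.card ∧ 3 * S.card ≤ 4 * n ∧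
      (1 : ℝ≥0) ≤ (4 * complexity g * (n + 1) ^ 2 : ℕ) *
        ∑ M ∈ (nestFreeMatchings (2 * n)).filter (fun M => ∀ i, i ∈ S ↔ M i ∈ S), μ M := by
  classical
  set s := complexity g with hs
  obtain ⟨L, hLlen, hLsum, hL⟩ := exists_homogeneous_balanced_decomposition_of_complexity_le
    (le_refl s) (isHomogeneous_of_support_eq hg) hn
  -- the splits attached to the terms
  have hsplit : ∀ t ∈ L, ∃ S : Finset (Fin (2 * n)), 2 * n < 3 * S.card ∧ 3 * S.card ≤ 4 * n ∧
      ∀ x ∈ (t.2.1 * t.2.2).support, ∃ M ∈ nestFreeMatchings (2 * n),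
        arcExponent M = x ∧ ∀ i, i ∈ S ↔ M i ∈ S := by
    intro t ht
    obtain ⟨hhom, h1, h2, hne, hle⟩ := hL t ht
    have hsub : (t.2.1 * t.2.2).support ⊆
        (∑ M ∈ nestFreeMatchings (2 * n), arcMonomial ℝ≥0 M).support := by
      intro x hx
      rw [← nestFreeMatchingPoly_eq_sum_arcMonomial, ← hg, mem_support_iff]
      intro h0
      exact (mem_support_iff.1 hx) (le_antisymm ((hle x).trans h0.le) zero_le)
    obtain ⟨S, hScard, hS⟩ := exists_balanced_vertex_split_of_support_subset
      nestFreeMatchings_subset_perfectMatchings hhom hne hsub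
    exact ⟨S, by omega, by omega, hS⟩
  choose! Sp hSp using hsplit
  -- every nest-free matching lies in the class of some term
  have hcover : ∀ M ∈ nestFreeMatchings (2 * n), ∃ t ∈ L, ∀ i, i ∈ Sp t ↔ M i ∈ Sp t := by
    intro M hM
    have hx : arcExponent M ∈ g.support := by
      rw [hg, support_nestFreeMatchingPoly, mem_image]
      exact ⟨M, hM, rfl⟩
    have hx' : ∃ t ∈ L, arcExponent M ∈ (t.2.1 * t.2.2).support := by
      by_contra hcon
      push Not at hcon
      rw [mem_support_iff, ← hLsum] at hx
      apply hx
      rw [← coeffAddMonoidHom_apply, map_list_sum]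
      apply List.sum_eq_zero
      intro c hc
      rw [List.map_map, List.mem_map] at hc
      obtain ⟨t, ht, rfl⟩ := hc
      simpa [coeffAddMonoidHom_apply, notMem_support_iff] using hcon t ht
    obtain ⟨t, ht, hxt⟩ := hx'
    obtain ⟨M', hM', hM'x, hresp⟩ := (hSp t ht).2.2 _ hxt
    have hMM' : M' = M := arcExponent_injOn (nestFreeMatchings_subset_perfectMatchings hM')
      (nestFreeMatchings_subset_perfectMatchings hM) hM'x
    subst hMM'
    exact ⟨t, ht, hresp⟩
  -- the union bound
  set T := L.toFinset with hT
  set mass : (ℕ × MvPolynomial (Fin (2 * n) × Fin (2 * n)) ℝ≥0 ×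
      MvPolynomial (Fin (2 * n) × Fin (2 * n)) ℝ≥0) → ℝ≥0 := fun t =>
    ∑ M ∈ (nestFreeMatchings (2 * n)).filter (fun M => ∀ i, i ∈ Sp t ↔ M i ∈ Sp t), μ M
    with hmass
  have hbound : (1 : ℝ≥0) ≤ ∑ t ∈ T, mass t := by
    rw [← hμ]
    have hrw : ∀ t ∈ T, mass t = ∑ M ∈ nestFreeMatchings (2 * n),
        if (∀ i, i ∈ Sp t ↔ M i ∈ Sp t) then μ M else 0 := by
      intro t _
      simp only [hmass]
      rw [sum_filter]
    rw [sum_congr rfl hrw, sum_comm]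
    refine sum_le_sum fun M hM => ?_
    obtain ⟨t, ht, hresp⟩ := hcover M hM
    have ht' : t ∈ T := by rw [hT, List.mem_toFinset]; exact ht
    refine le_trans ?_ (single_le_sum (f := fun t => if (∀ i, i ∈ Sp t ↔ M i ∈ Sp t)
      then μ M else 0) (fun _ _ => zero_le) ht')
    simp only [if_pos hresp, le_refl]
  have hTne : T.Nonempty := by
    rw [nonempty_iff_ne_empty]
    rintro hTe
    rw [hTe, sum_empty] at hbound
    exact absurd hbound (by simp)
  obtain ⟨t₀, ht₀, hmax⟩ := exists_max_image T mass hTne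
  have ht₀L : t₀ ∈ L := by rw [hT, List.mem_toFinset] at ht₀; exact ht₀
  refine ⟨Sp t₀, (hSp t₀ ht₀L).1, (hSp t₀ ht₀L).2.1, ?_⟩
  calc (1 : ℝ≥0) ≤ ∑ t ∈ T, mass t := hbound
    _ ≤ ∑ _t ∈ T, mass t₀ := sum_le_sum hmax
    _ = (T.card : ℝ≥0) * mass t₀ := by rw [sum_const, nsmul_eq_mul]
    _ ≤ ((4 * s * (n + 1) ^ 2 : ℕ) : ℝ≥0) * mass t₀ := by
        gcongr
        exact_mod_cast (List.toFinset_card_le (l := L)).trans hLlen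

/-- **Lower bound from a spread measure, support-generic.** If a probability weighting of the
nest-free perfect matchings of `[2n]` (`n ≥ 3`) respects every balanced split with mass `≤ β`,
then `1 ≤ 4 · L₊(g) · (n+1)² · β` for every `g` with the support of `NN_n`. [folklore] -/
theorem one_le_complexity_mul_of_spread_of_support_eq {n : ℕ} (hn : 3 ≤ n)
    {g : MvPolynomial (Fin (2 * n) × Fin (2 * n)) ℝ≥0}
    (hg : g.support = (nestFreeMatchingPoly n ℝ≥0).support) {β : ℝ≥0}
    (μ : (Fin (2 * n) → Fin (2 * n)) → ℝ≥0) (hμ : ∑ M ∈ nestFreeMatchings (2 * n), μ M = 1)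
    (hβ : ∀ S : Finset (Fin (2 * n)), 2 * n < 3 * S.card → 3 * S.card ≤ 4 * n →
      (∑ M ∈ (nestFreeMatchings (2 * n)).filter (fun M => ∀ i, i ∈ S ↔ M i ∈ S), μ M) ≤ β) :
    (1 : ℝ) ≤ 4 * (complexity g : ℝ) * ((n : ℝ) + 1) ^ 2 * (β : ℝ) := by
  obtain ⟨S, h1, h2, hbig⟩ := exists_balanced_split_of_complexity_of_support_eq hn hg μ hμ
  have h := hbig.trans (mul_le_mul_of_nonneg_left (hβ S h1 h2) zero_le)
  have h' := NNReal.coe_le_coe.2 h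
  push_cast at h'
  linarith [h']

/-! ### The thick-queue measure beats `2^u`, `n^{1/6} ≤ u` -/

/-- **The spread measure of `NNMonotoneExpBound`, with the measure exposed.** For all large `n`
there are `u` with `n^{1/6} ≤ u`, a bound `β`, and a probability weighting of the nest-free
perfect matchings of `[2n]` respecting every balanced split with mass `≤ β`, such that
`4 · 2^u · (n+1)² · β < 1` (the parameter bookkeeping of `NNMonotoneExpBound.exp_lower_bound`:
`u` = the largest integer with `T(u) = 192u⁵ + 176u⁴ + 29u³ + 24u + 4 ≤ n`, `m = u³`,
`L = 8mu + 3m`, `K = 2L + 4m + 2`, `N = 2n - 2L`, `β = 2N (3/4)^{4u}`). [folklore] -/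
theorem exists_spread_measure_beating : ∃ n₀ : ℕ, ∀ n : ℕ, n₀ ≤ n → 3 ≤ n ∧
    ∃ (u : ℕ) (β : ℝ≥0) (μ : (Fin (2 * n) → Fin (2 * n)) → ℝ≥0),
      (∑ Mt ∈ nestFreeMatchings (2 * n), μ Mt = 1) ∧
      (∀ S : Finset (Fin (2 * n)), 2 * n < 3 * S.card → 3 * S.card ≤ 4 * n →
        (∑ Mt ∈ (nestFreeMatchings (2 * n)).filter (fun Mt => ∀ i, i ∈ S ↔ Mt i ∈ S), μ Mt)
          ≤ β) ∧
      4 * (2 : ℝ) ^ u * ((n : ℝ) + 1) ^ 2 * (β : ℝ) < 1 ∧ (n : ℝ) ^ ((1 : ℝ) / 6) ≤ u := by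
  -- the two asymptotic requirements and `u ≥ 13600`, eventually in `u`
  have hexp0 : 0 ≤ Real.exp (-(1 / 54400 : ℝ)) := (Real.exp_pos _).le
  have hexp1 : Real.exp (-(1 / 54400 : ℝ)) < 1 := Real.exp_lt_one_iff.2 (by norm_num)
  have E1 := eventually_const_mul_pow_mul_pow_lt 10 (C := 4 * 27200 ^ 2) hexp0 hexp1 one_pos
  have E2 := eventually_const_mul_pow_mul_pow_lt 15 (C := 4 * 13601 ^ 2 * 54400)
    (a := 81 / 128) (by norm_num) (by norm_num) one_pos
  obtain ⟨u₀, hu₀⟩ := Filter.eventually_atTop.1 ((eventually_ge_atTop 13600).and (E1.and E2))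
  -- threshold `T(u) = 192u⁵ + 176u⁴ + 29u³ + 24u + 4`; `n₀ := T(u₀)`
  refine ⟨192 * u₀ ^ 5 + 176 * u₀ ^ 4 + 29 * u₀ ^ 3 + 24 * u₀ + 4, fun n hn => ?_⟩
  -- choose `u`: the largest with `T(u) ≤ n`
  set u : ℕ := Nat.findGreatest
    (fun u => 192 * u ^ 5 + 176 * u ^ 4 + 29 * u ^ 3 + 24 * u + 4 ≤ n) n with hu_def
  have hu₀n : u₀ ≤ n := le_trans (by omega) hn
  have hu₀u : u₀ ≤ u :=
    Nat.le_findGreatest (P := fun u => 192 * u ^ 5 + 176 * u ^ 4 + 29 * u ^ 3 + 24 * u + 4 ≤ n)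
      hu₀n hn
  have hTu : 192 * u ^ 5 + 176 * u ^ 4 + 29 * u ^ 3 + 24 * u + 4 ≤ n :=
    Nat.findGreatest_spec (P := fun u => 192 * u ^ 5 + 176 * u ^ 4 + 29 * u ^ 3 + 24 * u + 4 ≤ n)
      hu₀n hn
  have hule : u ≤ n :=
    Nat.findGreatest_le (P := fun u => 192 * u ^ 5 + 176 * u ^ 4 + 29 * u ^ 3 + 24 * u + 4 ≤ n) n
  have hun : u < n := by
    rcases hule.eq_or_lt with h | h
    · exfalso
      have hTu' := hTu
      rw [h] at hTu'
      omega
    · exact h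
  have hTu1 : ¬ (192 * (u + 1) ^ 5 + 176 * (u + 1) ^ 4 + 29 * (u + 1) ^ 3 + 24 * (u + 1) + 4 ≤ n) :=
    Nat.findGreatest_is_greatest
      (P := fun u => 192 * u ^ 5 + 176 * u ^ 4 + 29 * u ^ 3 + 24 * u + 4 ≤ n) (lt_add_one u)
      (by omega)
  obtain ⟨hu13600, hE1, hE2⟩ := hu₀ u hu₀u
  have hu1 : 1 ≤ u := le_trans (by norm_num) hu13600
  -- `n < T(u+1) ≤ 13600 u⁵`
  have hn_lt : n < 13600 * u ^ 5 := by
    have h2 : u + 1 ≤ 2 * u := by omega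
    have h5 : (u + 1) ^ 5 ≤ 32 * u ^ 5 := by
      calc (u + 1) ^ 5 ≤ (2 * u) ^ 5 := Nat.pow_le_pow_left h2 5
        _ = 32 * u ^ 5 := by ring
    have h1' : 1 ≤ u + 1 := by omega
    have h45 : (u + 1) ^ 4 ≤ (u + 1) ^ 5 := Nat.pow_le_pow_right h1' (by norm_num)
    have h35 : (u + 1) ^ 3 ≤ (u + 1) ^ 5 := Nat.pow_le_pow_right h1' (by norm_num)
    have h15 : (u + 1) ≤ (u + 1) ^ 5 := by
      calc (u + 1) = (u + 1) ^ 1 := (pow_one _).symm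
        _ ≤ (u + 1) ^ 5 := Nat.pow_le_pow_right h1' (by norm_num)
    omega
  -- the parameters
  set m : ℕ := u ^ 3 with hm
  set L : ℕ := 8 * m * u + 3 * m with hL
  set K : ℕ := 2 * L + 4 * m + 2 with hK
  set N : ℕ := 2 * n - 2 * L with hN
  have hT : 12 * K * u + 3 * L + 2 * K ≤ n := by
    have : 12 * K * u + 3 * L + 2 * K = 192 * u ^ 5 + 176 * u ^ 4 + 29 * u ^ 3 + 24 * u + 4 := by
      simp only [hK, hL, hm]; ring
    rw [this]; exact hTu
  have hNle : N ≤ 2 * n := by rw [hN]; omega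
  have hNpos : 0 < N := by
    have eT : 12 * K * u = 12 * (K * u) := by ring
    rw [eT] at hT
    rw [hN]; omega
  have hn3 : 3 ≤ n := by omega
  -- real-valued size bounds
  have hur : (1 : ℝ) ≤ u := by exact_mod_cast hu1
  have hnr : (n : ℝ) ≤ 13600 * (u : ℝ) ^ 5 := by exact_mod_cast hn_lt.le
  have hNr : (0 : ℝ) < N := by exact_mod_cast hNpos
  have hN2 : (N : ℝ) ≤ 2 * n := by exact_mod_cast hNle
  have hNr5 : (N : ℝ) ≤ 27200 * (u : ℝ) ^ 5 := by linarith
  -- the band estimate `2N e^{-m²/(2N)} 2^N ≤ 2^N/(2N)`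
  have hband : 2 * (N : ℝ) * Real.exp (-((m : ℝ) ^ 2 / (2 * N))) * 2 ^ N ≤ 2 ^ N / (2 * N) := by
    -- `m²/(2N) ≥ u/54400`
    have h1 : (u : ℝ) / 54400 ≤ (m : ℝ) ^ 2 / (2 * N) := by
      rw [div_le_div_iff₀ (by norm_num) (mul_pos (by norm_num) hNr)]
      have hm6 : (m : ℝ) ^ 2 = (u : ℝ) ^ 6 := by
        rw [hm]; push_cast; ring
      rw [hm6]
      have : (u : ℝ) * (2 * N) ≤ (u : ℝ) * (54400 * (u : ℝ) ^ 5) := by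
        have hu0 : (0 : ℝ) ≤ u := by positivity
        nlinarith
      nlinarith
    have h2 : Real.exp (-((m : ℝ) ^ 2 / (2 * N))) ≤ Real.exp (-(1 / 54400 : ℝ)) ^ u := by
      rw [← Real.exp_nat_mul, Real.exp_le_exp]
      have : (u : ℝ) * -(1 / 54400 : ℝ) = -((u : ℝ) / 54400) := by ring
      rw [this]
      linarith
    have h3 : 4 * (N : ℝ) ^ 2 * Real.exp (-((m : ℝ) ^ 2 / (2 * N))) ≤ 1 := by
      calc 4 * (N : ℝ) ^ 2 * Real.exp (-((m : ℝ) ^ 2 / (2 * N)))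
          ≤ 4 * (27200 * (u : ℝ) ^ 5) ^ 2 * Real.exp (-(1 / 54400 : ℝ)) ^ u := by
            gcongr
        _ = 4 * 27200 ^ 2 * (u : ℝ) ^ 10 * Real.exp (-(1 / 54400 : ℝ)) ^ u := by ring
        _ ≤ 1 := hE1.le
    have hN0 : (N : ℝ) ≠ 0 := hNr.ne'
    rw [show 2 * (N : ℝ) * Real.exp (-((m : ℝ) ^ 2 / (2 * N))) * 2 ^ N
        = (4 * (N : ℝ) ^ 2 * Real.exp (-((m : ℝ) ^ 2 / (2 * N)))) * (2 ^ N / (2 * N)) by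
      field_simp; ring]
    calc (4 * (N : ℝ) ^ 2 * Real.exp (-((m : ℝ) ^ 2 / (2 * N)))) * (2 ^ N / (2 * N))
        ≤ 1 * (2 ^ N / (2 * N)) := by gcongr
      _ = 2 ^ N / (2 * N) := one_mul _
  -- the measure
  obtain ⟨μ, hμ1, hμS⟩ := exists_thick_measure_of_le hu1 hm hL hK hN hT hband
  refine ⟨hn3, u, (2 * N : ℝ≥0) * ((3 : ℝ≥0) / 4) ^ (4 * u), μ, hμ1, hμS, ?_, ?_⟩
  · -- `4 · 2^u (n+1)² · 2N (3/4)^{4u} ≤ 4 · 13601² · 54400 · u¹⁵ (81/128)^u < 1`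
    push_cast
    have hpow : (2 : ℝ) ^ u * (3 / 4 : ℝ) ^ (4 * u) = (81 / 128 : ℝ) ^ u := by
      rw [pow_mul, ← mul_pow]; norm_num
    have hn1 : (n : ℝ) + 1 ≤ 13601 * (u : ℝ) ^ 5 := by
      have : (1 : ℝ) ≤ (u : ℝ) ^ 5 := one_le_pow₀ hur
      linarith
    have hB : ((n : ℝ) + 1) ^ 2 ≤ (13601 * (u : ℝ) ^ 5) ^ 2 := by gcongr
    calc 4 * (2 : ℝ) ^ u * ((n : ℝ) + 1) ^ 2 * (2 * (N : ℝ) * (3 / 4 : ℝ) ^ (4 * u))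
        = 4 * ((n : ℝ) + 1) ^ 2 * (2 * (N : ℝ)) * ((2 : ℝ) ^ u * (3 / 4 : ℝ) ^ (4 * u)) := by
          ring
      _ = 4 * ((n : ℝ) + 1) ^ 2 * (2 * (N : ℝ)) * (81 / 128 : ℝ) ^ u := by rw [hpow]
      _ ≤ 4 * (13601 * (u : ℝ) ^ 5) ^ 2 * (2 * (27200 * (u : ℝ) ^ 5)) * (81 / 128 : ℝ) ^ u := by
          gcongr
      _ = 4 * 13601 ^ 2 * 54400 * (u : ℝ) ^ 15 * (81 / 128 : ℝ) ^ u := by ring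
      _ < 1 := hE2
  · -- `n^{1/6} ≤ u`
    have hn6 : (n : ℝ) ≤ (u : ℝ) ^ 6 := by
      have h13600 : (13600 : ℝ) ≤ u := by exact_mod_cast hu13600
      have hu5 : (0 : ℝ) ≤ (u : ℝ) ^ 5 := by positivity
      calc (n : ℝ) ≤ 13600 * (u : ℝ) ^ 5 := hnr
        _ ≤ (u : ℝ) * (u : ℝ) ^ 5 := mul_le_mul_of_nonneg_right h13600 hu5
        _ = (u : ℝ) ^ 6 := by ring
    have h := Real.rpow_le_rpow (Nat.cast_nonneg n) hn6 (by norm_num : (0 : ℝ) ≤ 1 / 6)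
    have h6 : ((u : ℝ) ^ 6) ^ ((1 : ℝ) / 6) = u := by
      rw [show ((1 : ℝ) / 6) = ((6 : ℕ) : ℝ)⁻¹ by norm_num]
      exact Real.pow_rpow_inv_natCast (Nat.cast_nonneg u) (by norm_num)
    rw [h6] at h
    exact h

/-- **`2^{n^{1/6}} ≤ L₊(g)` for every `g` with the support of `NN_n`, `n` large** (the
support-generic form of `NNMonotoneExpBound.exp_lower_bound`, same threshold). [folklore] -/
theorem exp_lower_bound_of_support_eq : ∃ n₀ : ℕ, ∀ n : ℕ, n₀ ≤ n →
    ∀ g : MvPolynomial (Fin (2 * n) × Fin (2 * n)) ℝ≥0,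
      g.support = (nestFreeMatchingPoly n ℝ≥0).support →
      (2 : ℝ) ^ ((n : ℝ) ^ ((1 : ℝ) / 6)) ≤ (complexity g : ℝ) := by
  obtain ⟨n₀, h⟩ := exists_spread_measure_beating
  refine ⟨n₀, fun n hn g hg => ?_⟩
  obtain ⟨hn3, u, β, μ, hμ1, hμS, hfin, hroot⟩ := h n hn
  have hmain := one_le_complexity_mul_of_spread_of_support_eq hn3 hg μ hμ1 hμS
  set s : ℕ := complexity g with hs
  have h2u : (2 : ℝ) ^ u ≤ (s : ℝ) := by
    by_contra hlt
    rw [not_le] at hlt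
    have hpos : (0 : ℝ) ≤ ((n : ℝ) + 1) ^ 2 * (β : ℝ) := by positivity
    have hle : 4 * (s : ℝ) * ((n : ℝ) + 1) ^ 2 * (β : ℝ) ≤
        4 * (2 : ℝ) ^ u * ((n : ℝ) + 1) ^ 2 * (β : ℝ) := by
      have := mul_le_mul_of_nonneg_right hlt.le hpos
      nlinarith
    linarith
  calc (2 : ℝ) ^ ((n : ℝ) ^ ((1 : ℝ) / 6)) ≤ (2 : ℝ) ^ ((u : ℕ) : ℝ) :=
        Real.rpow_le_rpow_of_exponent_le (by norm_num) hroot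
    _ = (2 : ℝ) ^ u := Real.rpow_natCast 2 u
    _ ≤ s := h2u

end Summit.ValiantsHypothesis.ValiantsHypothesis.Theorems.FifoMatching.NNLowDegreeCofactorHard

end
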